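import Summits.CriticalPhenomena.PercolationContinuityZ3.Theorems.PercNearOneGluingNoHeavyLowerTailKnQuestion8CoefficientwiseCoreClassSeriesClusters
import HarnessLib

/-!
# KB-SERIES, the easy cells: payments by the domination maps of the parts

Support file (`--supports stmt-CriticalPhenomena-4575`, closed), prover `prim-cplus-coupling` (gen 31).  No definitions, no notations, no named facts,
no sorries; standard axioms.  Memo `prim-cplus-coupling/A5-COUPLING-gen31.md` §2, §2b.  Companions `…CoreClassSeriesClusters` (cut-vertex cluster
identities), `…CoreClassSeriesC6` (the contact cell), `…CoreClassSeriesMain` (assembly).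

Setting: `E₁, E₂` edge sets meeting only at the cut vertex `c` (`hsep`); terminals `a` (on no edge of `E₂`) and `b` (on no edge of `E₁`); colourings
`ω = ω₁ ∪ ω₂`, `ω₁ ⊆ E₁`, `ω₂ ⊆ E₂`; in the composed graph `P = C_a(ω)`, `Q = C_b((E₁∖ω₁) ∪ (E₂∖ω₂))`, `S = C_a(ω) ∪ C_b(ω)`; supply term
`Y = h(S)k(S)`, wall term `M = (hᵃP − hᵇQ)(kᵃP − kᵇQ)`.  Side events: `c ∈ C_a(ω₁)` (`a` red-joined to `c` in `H₁`), `c ∈ C_a(E₁∖ω₁)`,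
`b ∈ C_c(ω₂)`, `b ∈ C_c(E₂∖ω₂)`.  Each theorem pairs one CELL of the wall of the composed graph with a disjoint SLICE of its supply (memo §2b):
* `Coefficientwise.seriesCell_E` — cell `{c ∉ C_a ω₁} × {b ∉ C_c(E₂∖ω₂)}` against the slice `{c ∉ C_a ω₁} × {b ∉ C_c ω₂}` (swap on `E₂`).
* `Coefficientwise.seriesCell_C3` — cell `{c ∈ C_a ω₁} × T₂` against `{c ∈ C_a ω₁} × {b ∉ C_c ω₂}` through a proper domination map `ψ₂` of `(E₂; c, b)`.
* `Coefficientwise.seriesCell_C1` — cell `T₁ × {b ∈ C_c(E₂∖ω₂)}` against `{c ∉ C_a ω₁} × {b ∈ C_c ω₂}` through a proper domination map `ψ₁` of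
  `(E₁; a, c)` and the swap on `E₂`.
All termwise by `mul_add_sub_mul_sub_nonneg` once the supply set at the image configuration is shown to contain `P ∪ Q`.
[cite: KozmaNitzan2024, Questions 8–9 (§5.5 p. 36) (context: the Question-8 pocket covariance programme)]
-/

namespace Summit.CriticalPhenomena.PercolationContinuityZ3.Theorems

open Finset Literature.Probability.Percolation

namespace Coefficientwise

variable {ι V : Type*}

open Classical in
/-- **Cell E** (`a` not red-joined to `c`, `b` not blue-joined to `c`): paid by the supply slice `{c ∉ C_a ω₁} × {b ∉ C_c ω₂}` through the colour
swap on `E₂`. [cite: KozmaNitzan2024, Questions 8–9 (§5.5 p. 36) (context)] -/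
theorem seriesCell_E (ends : ι → Sym2 V) (E₁ E₂ : Finset ι) (c a b : V)
    (hsep : ∀ i ∈ E₁, ∀ j ∈ E₂, ∀ u, u ∈ ends i → u ∈ ends j → u = c)
    (haE : ∀ j ∈ E₂, a ∉ ends j) (hbE : ∀ i ∈ E₁, b ∉ ends i)
    (h k ha hb ka kb : Set V → ℝ) (hh : Monotone h) (hk : Monotone k)
    (ha0 : ∀ X, 0 ≤ ha X) (hah : ∀ X, ha X ≤ h X) (hb0 : ∀ X, 0 ≤ hb X) (hbh : ∀ X, hb X ≤ h X)
    (ka0 : ∀ X, 0 ≤ ka X) (kak : ∀ X, ka X ≤ k X) (kb0 : ∀ X, 0 ≤ kb X) (kbk : ∀ X, kb X ≤ k X) :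
    0 ≤ ∑ ω₁ ∈ E₁.powerset, ∑ ω₂ ∈ E₂.powerset,
      ((if c ∉ openCluster (ends '' (↑ω₁ : Set ι)) a ∧ b ∉ openCluster (ends '' (↑ω₂ : Set ι)) c then
          h (openCluster (ends '' (↑(ω₁ ∪ ω₂) : Set ι)) a ∪ openCluster (ends '' (↑(ω₁ ∪ ω₂) : Set ι)) b) *
            k (openCluster (ends '' (↑(ω₁ ∪ ω₂) : Set ι)) a ∪ openCluster (ends '' (↑(ω₁ ∪ ω₂) : Set ι)) b) else 0)
      + (if c ∉ openCluster (ends '' (↑ω₁ : Set ι)) a ∧ b ∉ openCluster (ends '' (↑(E₂ \ ω₂) : Set ι)) c then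
          (ha (openCluster (ends '' (↑(ω₁ ∪ ω₂) : Set ι)) a) - hb (openCluster (ends '' (↑((E₁ \ ω₁) ∪ (E₂ \ ω₂)) : Set ι)) b)) *
            (ka (openCluster (ends '' (↑(ω₁ ∪ ω₂) : Set ι)) a) - kb (openCluster (ends '' (↑((E₁ \ ω₁) ∪ (E₂ \ ω₂)) : Set ι)) b)) else 0)) := by
  set C : Finset ι → V → Set V := fun ω v => openCluster (ends '' (↑ω : Set ι)) v with hC
  change 0 ≤ ∑ ω₁ ∈ E₁.powerset, ∑ ω₂ ∈ E₂.powerset,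
      ((if c ∉ C ω₁ a ∧ b ∉ C ω₂ c then h (C (ω₁ ∪ ω₂) a ∪ C (ω₁ ∪ ω₂) b) * k (C (ω₁ ∪ ω₂) a ∪ C (ω₁ ∪ ω₂) b) else 0)
      + (if c ∉ C ω₁ a ∧ b ∉ C (E₂ \ ω₂) c then
          (ha (C (ω₁ ∪ ω₂) a) - hb (C ((E₁ \ ω₁) ∪ (E₂ \ ω₂)) b)) * (ka (C (ω₁ ∪ ω₂) a) - kb (C ((E₁ \ ω₁) ∪ (E₂ \ ω₂)) b)) else 0))
  have hCmono : ∀ {ω ω' : Finset ι} (v : V), ω ⊆ ω' → C ω v ⊆ C ω' v := fun v hle => openCluster_image_mono ends hle v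
  have hh0 : ∀ X, 0 ≤ h X := fun X => le_trans (ha0 X) (hah X)
  have hk0 : ∀ X, 0 ≤ k X := fun X => le_trans (ka0 X) (kak X)
  have cutA : ∀ ω₁ ω₂ : Finset ι, ω₁ ⊆ E₁ → ω₂ ⊆ E₂ → C (ω₁ ∪ ω₂) a = C ω₁ a ∪ {y | c ∈ C ω₁ a ∧ y ∈ C ω₂ c} :=
    fun ω₁ ω₂ h1 h2 => openCluster_cut_side ends E₁ E₂ ω₁ ω₂ c a hsep h1 h2 haE
  have cutB : ∀ ω₁ ω₂ : Finset ι, ω₁ ⊆ E₁ → ω₂ ⊆ E₂ → C (ω₁ ∪ ω₂) b = C ω₂ b ∪ {y | c ∈ C ω₂ b ∧ y ∈ C ω₁ c} := by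
    intro ω₁ ω₂ h1 h2
    rw [Finset.union_comm]
    exact openCluster_cut_side ends E₂ E₁ ω₂ ω₁ c b (fun i hi j hj u hui huj => hsep j hj i hi u huj hui) h2 h1 hbE
  refine Finset.sum_nonneg fun ω₁ hω₁ => ?_
  have hω₁ := Finset.mem_powerset.mp hω₁
  -- reindex the supply over ω₂ by the swap on E₂
  have hsw : ∑ ω₂ ∈ E₂.powerset, (if c ∉ C ω₁ a ∧ b ∉ C ω₂ c then h (C (ω₁ ∪ ω₂) a ∪ C (ω₁ ∪ ω₂) b) * k (C (ω₁ ∪ ω₂) a ∪ C (ω₁ ∪ ω₂) b) else 0)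
      = ∑ ω₂ ∈ E₂.powerset, (if c ∉ C ω₁ a ∧ b ∉ C (E₂ \ ω₂) c then
          h (C (ω₁ ∪ (E₂ \ ω₂)) a ∪ C (ω₁ ∪ (E₂ \ ω₂)) b) * k (C (ω₁ ∪ (E₂ \ ω₂)) a ∪ C (ω₁ ∪ (E₂ \ ω₂)) b) else 0) :=
    (sum_powerset_sdiff E₂ (fun ω₂ => if c ∉ C ω₁ a ∧ b ∉ C ω₂ c then
      h (C (ω₁ ∪ ω₂) a ∪ C (ω₁ ∪ ω₂) b) * k (C (ω₁ ∪ ω₂) a ∪ C (ω₁ ∪ ω₂) b) else 0)).symm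
  rw [Finset.sum_add_distrib, hsw, ← Finset.sum_add_distrib]
  refine Finset.sum_nonneg fun ω₂ hω₂ => ?_
  have hω₂ := Finset.mem_powerset.mp hω₂
  by_cases hE : c ∉ C ω₁ a ∧ b ∉ C (E₂ \ ω₂) c
  · rw [if_pos hE, if_pos hE]
    -- P ⊆ C_a(ω₁) ⊆ C_a(ω₁ ∪ (E₂∖ω₂)) and Q ⊆ C_b(E₂∖ω₂) ⊆ C_b(ω₁ ∪ (E₂∖ω₂))
    set Sst : Set V := C (ω₁ ∪ (E₂ \ ω₂)) a ∪ C (ω₁ ∪ (E₂ \ ω₂)) b with hSst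
    have hP : C (ω₁ ∪ ω₂) a ⊆ Sst := by
      intro y hy
      rw [cutA ω₁ ω₂ hω₁ hω₂] at hy
      rcases hy with hy | ⟨hc, _⟩
      · exact Or.inl (hCmono a Finset.subset_union_left hy)
      · exact absurd hc hE.1
    have hQ : C ((E₁ \ ω₁) ∪ (E₂ \ ω₂)) b ⊆ Sst := by
      intro y hy
      rw [cutB (E₁ \ ω₁) (E₂ \ ω₂) Finset.sdiff_subset Finset.sdiff_subset] at hy
      rcases hy with hy | ⟨hc, _⟩
      · exact Or.inr (hCmono b Finset.subset_union_right hy)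
      · exact absurd ((mem_openCluster_comm ends (E₂ \ ω₂) b c).mp hc) hE.2
    have := mul_add_sub_mul_sub_nonneg (A := h Sst) (B := k Sst)
      (α := ha (C (ω₁ ∪ ω₂) a)) (β := hb (C ((E₁ \ ω₁) ∪ (E₂ \ ω₂)) b)) (γ := ka (C (ω₁ ∪ ω₂) a)) (δ := kb (C ((E₁ \ ω₁) ∪ (E₂ \ ω₂)) b))
      (ha0 _) (le_trans (hah _) (hh hP)) (hb0 _) (le_trans (hbh _) (hh hQ))
      (ka0 _) (le_trans (kak _) (hk hP)) (kb0 _) (le_trans (kbk _) (hk hQ))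
    linarith
  · rw [if_neg hE, if_neg hE]; linarith

open Classical in
/-- **Cell C3** (`a` red-joined to `c` in `H₁`, `ω₂` on the wall of `(E₂; c, b)`): paid by the supply slice `{c ∈ C_a ω₁} × {b ∉ C_c ω₂}` through a
PROPER domination map `ψ₂` of `(E₂; c, b)`. [cite: KozmaNitzan2024, Questions 8–9 (§5.5 p. 36) (context)] -/
theorem seriesCell_C3 (ends : ι → Sym2 V) (E₁ E₂ : Finset ι) (c a b : V)
    (hsep : ∀ i ∈ E₁, ∀ j ∈ E₂, ∀ u, u ∈ ends i → u ∈ ends j → u = c)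
    (haE : ∀ j ∈ E₂, a ∉ ends j) (hbE : ∀ i ∈ E₁, b ∉ ends i)
    (h k ha hb ka kb : Set V → ℝ) (hh : Monotone h) (hk : Monotone k)
    (ha0 : ∀ X, 0 ≤ ha X) (hah : ∀ X, ha X ≤ h X) (hb0 : ∀ X, 0 ≤ hb X) (hbh : ∀ X, hb X ≤ h X)
    (ka0 : ∀ X, 0 ≤ ka X) (kak : ∀ X, ka X ≤ k X) (kb0 : ∀ X, 0 ≤ kb X) (kbk : ∀ X, kb X ≤ k X)
    (ψ₂ : Finset ι → Finset ι)
    (hψE : ∀ ω, ω ⊆ E₂ → b ∉ openCluster (ends '' (↑ω : Set ι)) c → b ∉ openCluster (ends '' (↑(E₂ \ ω) : Set ι)) c → ψ₂ ω ⊆ E₂)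
    (hψcov : ∀ ω, ω ⊆ E₂ → b ∉ openCluster (ends '' (↑ω : Set ι)) c → b ∉ openCluster (ends '' (↑(E₂ \ ω) : Set ι)) c →
      openCluster (ends '' (↑ω : Set ι)) c ∪ openCluster (ends '' (↑(E₂ \ ω) : Set ι)) b ⊆
        openCluster (ends '' (↑(ψ₂ ω) : Set ι)) c ∪ openCluster (ends '' (↑(ψ₂ ω) : Set ι)) b)
    (hψinj : ∀ ω ω', ω ⊆ E₂ → b ∉ openCluster (ends '' (↑ω : Set ι)) c → b ∉ openCluster (ends '' (↑(E₂ \ ω) : Set ι)) c →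
      ω' ⊆ E₂ → b ∉ openCluster (ends '' (↑ω' : Set ι)) c → b ∉ openCluster (ends '' (↑(E₂ \ ω') : Set ι)) c → ψ₂ ω = ψ₂ ω' → ω = ω')
    (hψprop : ∀ ω, ω ⊆ E₂ → b ∉ openCluster (ends '' (↑ω : Set ι)) c → b ∉ openCluster (ends '' (↑(E₂ \ ω) : Set ι)) c →
      b ∉ openCluster (ends '' (↑(ψ₂ ω) : Set ι)) c) :
    0 ≤ ∑ ω₁ ∈ E₁.powerset, ∑ ω₂ ∈ E₂.powerset,
      ((if c ∈ openCluster (ends '' (↑ω₁ : Set ι)) a ∧ b ∉ openCluster (ends '' (↑ω₂ : Set ι)) c then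
          h (openCluster (ends '' (↑(ω₁ ∪ ω₂) : Set ι)) a ∪ openCluster (ends '' (↑(ω₁ ∪ ω₂) : Set ι)) b) *
            k (openCluster (ends '' (↑(ω₁ ∪ ω₂) : Set ι)) a ∪ openCluster (ends '' (↑(ω₁ ∪ ω₂) : Set ι)) b) else 0)
      + (if c ∈ openCluster (ends '' (↑ω₁ : Set ι)) a ∧ (b ∉ openCluster (ends '' (↑ω₂ : Set ι)) c ∧ b ∉ openCluster (ends '' (↑(E₂ \ ω₂) : Set ι)) c) then
          (ha (openCluster (ends '' (↑(ω₁ ∪ ω₂) : Set ι)) a) - hb (openCluster (ends '' (↑((E₁ \ ω₁) ∪ (E₂ \ ω₂)) : Set ι)) b)) *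
            (ka (openCluster (ends '' (↑(ω₁ ∪ ω₂) : Set ι)) a) - kb (openCluster (ends '' (↑((E₁ \ ω₁) ∪ (E₂ \ ω₂)) : Set ι)) b)) else 0)) := by
  set C : Finset ι → V → Set V := fun ω v => openCluster (ends '' (↑ω : Set ι)) v with hC
  change 0 ≤ ∑ ω₁ ∈ E₁.powerset, ∑ ω₂ ∈ E₂.powerset,
      ((if c ∈ C ω₁ a ∧ b ∉ C ω₂ c then h (C (ω₁ ∪ ω₂) a ∪ C (ω₁ ∪ ω₂) b) * k (C (ω₁ ∪ ω₂) a ∪ C (ω₁ ∪ ω₂) b) else 0)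
      + (if c ∈ C ω₁ a ∧ (b ∉ C ω₂ c ∧ b ∉ C (E₂ \ ω₂) c) then
          (ha (C (ω₁ ∪ ω₂) a) - hb (C ((E₁ \ ω₁) ∪ (E₂ \ ω₂)) b)) * (ka (C (ω₁ ∪ ω₂) a) - kb (C ((E₁ \ ω₁) ∪ (E₂ \ ω₂)) b)) else 0))
  have hCmono : ∀ {ω ω' : Finset ι} (v : V), ω ⊆ ω' → C ω v ⊆ C ω' v := fun v hle => openCluster_image_mono ends hle v
  have hh0 : ∀ X, 0 ≤ h X := fun X => le_trans (ha0 X) (hah X)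
  have hk0 : ∀ X, 0 ≤ k X := fun X => le_trans (ka0 X) (kak X)
  have cutA : ∀ ω₁ ω₂ : Finset ι, ω₁ ⊆ E₁ → ω₂ ⊆ E₂ → C (ω₁ ∪ ω₂) a = C ω₁ a ∪ {y | c ∈ C ω₁ a ∧ y ∈ C ω₂ c} :=
    fun ω₁ ω₂ h1 h2 => openCluster_cut_side ends E₁ E₂ ω₁ ω₂ c a hsep h1 h2 haE
  have cutB : ∀ ω₁ ω₂ : Finset ι, ω₁ ⊆ E₁ → ω₂ ⊆ E₂ → C (ω₁ ∪ ω₂) b = C ω₂ b ∪ {y | c ∈ C ω₂ b ∧ y ∈ C ω₁ c} := by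
    intro ω₁ ω₂ h1 h2
    rw [Finset.union_comm]
    exact openCluster_cut_side ends E₂ E₁ ω₂ ω₁ c b (fun i hi j hj u hui huj => hsep j hj i hi u huj hui) h2 h1 hbE
  refine Finset.sum_nonneg fun ω₁ hω₁ => ?_
  have hω₁ := Finset.mem_powerset.mp hω₁
  by_cases hc1 : c ∈ C ω₁ a
  swap
  · refine Finset.sum_nonneg fun ω₂ _ => ?_
    rw [if_neg (fun hx => hc1 hx.1), if_neg (fun hx => hc1 hx.1)]; linarith
  -- supply Y(ω₁, ·) restricted to {b ∉ C_c ω₂} dominates its part on ψ₂(T₂)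
  set Y : Finset ι → ℝ := fun ω₂ => h (C (ω₁ ∪ ω₂) a ∪ C (ω₁ ∪ ω₂) b) * k (C (ω₁ ∪ ω₂) a ∪ C (ω₁ ∪ ω₂) b) with hY
  have hY0 : ∀ ω₂, 0 ≤ Y ω₂ := fun ω₂ => mul_nonneg (hh0 _) (hk0 _)
  set T₂ : Finset (Finset ι) := E₂.powerset.filter (fun ω₂ => b ∉ C ω₂ c ∧ b ∉ C (E₂ \ ω₂) c) with hT₂
  have hT₂mem : ∀ {ω₂}, ω₂ ∈ T₂ ↔ ω₂ ⊆ E₂ ∧ b ∉ C ω₂ c ∧ b ∉ C (E₂ \ ω₂) c := fun {ω₂} => by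
    rw [hT₂, Finset.mem_filter, Finset.mem_powerset]
  have lower : ∑ ω₂ ∈ T₂, Y (ψ₂ ω₂) ≤ ∑ ω₂ ∈ E₂.powerset, (if c ∈ C ω₁ a ∧ b ∉ C ω₂ c then Y ω₂ else 0) := by
    have hinj : ∀ x ∈ T₂, ∀ y ∈ T₂, ψ₂ x = ψ₂ y → x = y := by
      intro x hx y hy he
      obtain ⟨s1, r1, b1⟩ := hT₂mem.mp hx
      obtain ⟨s2, r2, b2⟩ := hT₂mem.mp hy
      exact hψinj x y s1 r1 b1 s2 r2 b2 he
    have e1 : ∑ ω₂ ∈ T₂, Y (ψ₂ ω₂) = ∑ ω' ∈ T₂.image ψ₂, Y ω' := (Finset.sum_image (f := fun ω' => Y ω') hinj).symm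
    rw [e1, ← Finset.sum_filter]
    refine Finset.sum_le_sum_of_subset_of_nonneg ?_ (fun ω _ _ => hY0 ω)
    intro ω' hω'
    rw [Finset.mem_image] at hω'
    obtain ⟨ω₂, hω₂, rfl⟩ := hω'
    obtain ⟨s1, r1, b1⟩ := hT₂mem.mp hω₂
    rw [Finset.mem_filter, Finset.mem_powerset]
    exact ⟨hψE ω₂ s1 r1 b1, hc1, hψprop ω₂ s1 r1 b1⟩
  -- the wall part as a sum over T₂
  have wall_eq : ∑ ω₂ ∈ E₂.powerset, (if c ∈ C ω₁ a ∧ (b ∉ C ω₂ c ∧ b ∉ C (E₂ \ ω₂) c) then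
        (ha (C (ω₁ ∪ ω₂) a) - hb (C ((E₁ \ ω₁) ∪ (E₂ \ ω₂)) b)) * (ka (C (ω₁ ∪ ω₂) a) - kb (C ((E₁ \ ω₁) ∪ (E₂ \ ω₂)) b)) else 0)
      = ∑ ω₂ ∈ T₂, (ha (C (ω₁ ∪ ω₂) a) - hb (C ((E₁ \ ω₁) ∪ (E₂ \ ω₂)) b)) * (ka (C (ω₁ ∪ ω₂) a) - kb (C ((E₁ \ ω₁) ∪ (E₂ \ ω₂)) b)) := by
    rw [hT₂, Finset.sum_filter]
    refine Finset.sum_congr rfl fun ω₂ _ => ?_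
    by_cases hw : b ∉ C ω₂ c ∧ b ∉ C (E₂ \ ω₂) c
    · rw [if_pos ⟨hc1, hw⟩, if_pos hw]
    · rw [if_neg (fun hx => hw hx.2), if_neg hw]
  -- termwise on T₂
  have step : 0 ≤ ∑ ω₂ ∈ T₂, ((ha (C (ω₁ ∪ ω₂) a) - hb (C ((E₁ \ ω₁) ∪ (E₂ \ ω₂)) b)) * (ka (C (ω₁ ∪ ω₂) a) - kb (C ((E₁ \ ω₁) ∪ (E₂ \ ω₂)) b))
      + Y (ψ₂ ω₂)) := by
    refine Finset.sum_nonneg fun ω₂ hω₂ => ?_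
    obtain ⟨s2, r2, b2⟩ := hT₂mem.mp hω₂
    have hcov := hψcov ω₂ s2 r2 b2
    have hψs : ψ₂ ω₂ ⊆ E₂ := hψE ω₂ s2 r2 b2
    set Sst : Set V := C (ω₁ ∪ ψ₂ ω₂) a ∪ C (ω₁ ∪ ψ₂ ω₂) b with hSst
    -- c ∈ C_a(ω₁ ∪ ψ₂ω₂), so that cluster contains C_c(ψ₂ ω₂)
    have hca : c ∈ C (ω₁ ∪ ψ₂ ω₂) a := hCmono a Finset.subset_union_left hc1
    have hXψ : C (ψ₂ ω₂) c ⊆ Sst := fun y hy =>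
      Or.inl (SimpleGraph.Reachable.trans hca (hCmono c Finset.subset_union_right hy))
    have hBψ : C (ψ₂ ω₂) b ⊆ Sst := fun y hy => Or.inr (hCmono b Finset.subset_union_right hy)
    have hcovS : C ω₂ c ∪ C (E₂ \ ω₂) b ⊆ Sst := by
      intro y hy
      rcases hcov hy with h' | h'
      · exact hXψ h'
      · exact hBψ h'
    have hP : C (ω₁ ∪ ω₂) a ⊆ Sst := by
      intro y hy
      rw [cutA ω₁ ω₂ hω₁ s2] at hy
      rcases hy with hy | ⟨_, hy⟩
      · exact Or.inl (hCmono a Finset.subset_union_left hy)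
      · exact hcovS (Or.inl hy)
    have hQ : C ((E₁ \ ω₁) ∪ (E₂ \ ω₂)) b ⊆ Sst := by
      intro y hy
      rw [cutB (E₁ \ ω₁) (E₂ \ ω₂) Finset.sdiff_subset Finset.sdiff_subset] at hy
      rcases hy with hy | ⟨hc, _⟩
      · exact hcovS (Or.inr hy)
      · exact absurd ((mem_openCluster_comm ends (E₂ \ ω₂) b c).mp hc) b2
    have := mul_add_sub_mul_sub_nonneg (A := h Sst) (B := k Sst)
      (α := ha (C (ω₁ ∪ ω₂) a)) (β := hb (C ((E₁ \ ω₁) ∪ (E₂ \ ω₂)) b)) (γ := ka (C (ω₁ ∪ ω₂) a)) (δ := kb (C ((E₁ \ ω₁) ∪ (E₂ \ ω₂)) b))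
      (ha0 _) (le_trans (hah _) (hh hP)) (hb0 _) (le_trans (hbh _) (hh hQ))
      (ka0 _) (le_trans (kak _) (hk hP)) (kb0 _) (le_trans (kbk _) (hk hQ))
    simp only [hY]; linarith
  rw [Finset.sum_add_distrib, wall_eq]
  rw [Finset.sum_add_distrib] at step
  have hYsum : ∑ ω₂ ∈ E₂.powerset, (if c ∈ C ω₁ a ∧ b ∉ C ω₂ c then h (C (ω₁ ∪ ω₂) a ∪ C (ω₁ ∪ ω₂) b) * k (C (ω₁ ∪ ω₂) a ∪ C (ω₁ ∪ ω₂) b) else 0)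
      = ∑ ω₂ ∈ E₂.powerset, (if c ∈ C ω₁ a ∧ b ∉ C ω₂ c then Y ω₂ else 0) := rfl
  rw [hYsum]
  linarith

open Classical in
/-- **Cell C1** (`ω₁` on the wall of `(E₁; a, c)`, `b` blue-joined to `c` in `H₂`): paid by the supply slice `{c ∉ C_a ω₁} × {b ∈ C_c ω₂}` through a
PROPER domination map `ψ₁` of `(E₁; a, c)` and the colour swap on `E₂`. [cite: KozmaNitzan2024, Questions 8–9 (§5.5 p. 36) (context)] -/
theorem seriesCell_C1 (ends : ι → Sym2 V) (E₁ E₂ : Finset ι) (c a b : V)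
    (hsep : ∀ i ∈ E₁, ∀ j ∈ E₂, ∀ u, u ∈ ends i → u ∈ ends j → u = c)
    (haE : ∀ j ∈ E₂, a ∉ ends j) (hbE : ∀ i ∈ E₁, b ∉ ends i)
    (h k ha hb ka kb : Set V → ℝ) (hh : Monotone h) (hk : Monotone k)
    (ha0 : ∀ X, 0 ≤ ha X) (hah : ∀ X, ha X ≤ h X) (hb0 : ∀ X, 0 ≤ hb X) (hbh : ∀ X, hb X ≤ h X)
    (ka0 : ∀ X, 0 ≤ ka X) (kak : ∀ X, ka X ≤ k X) (kb0 : ∀ X, 0 ≤ kb X) (kbk : ∀ X, kb X ≤ k X)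
    (ψ₁ : Finset ι → Finset ι)
    (hψE : ∀ ω, ω ⊆ E₁ → c ∉ openCluster (ends '' (↑ω : Set ι)) a → c ∉ openCluster (ends '' (↑(E₁ \ ω) : Set ι)) a → ψ₁ ω ⊆ E₁)
    (hψcov : ∀ ω, ω ⊆ E₁ → c ∉ openCluster (ends '' (↑ω : Set ι)) a → c ∉ openCluster (ends '' (↑(E₁ \ ω) : Set ι)) a →
      openCluster (ends '' (↑ω : Set ι)) a ∪ openCluster (ends '' (↑(E₁ \ ω) : Set ι)) c ⊆
        openCluster (ends '' (↑(ψ₁ ω) : Set ι)) a ∪ openCluster (ends '' (↑(ψ₁ ω) : Set ι)) c)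
    (hψinj : ∀ ω ω', ω ⊆ E₁ → c ∉ openCluster (ends '' (↑ω : Set ι)) a → c ∉ openCluster (ends '' (↑(E₁ \ ω) : Set ι)) a →
      ω' ⊆ E₁ → c ∉ openCluster (ends '' (↑ω' : Set ι)) a → c ∉ openCluster (ends '' (↑(E₁ \ ω') : Set ι)) a → ψ₁ ω = ψ₁ ω' → ω = ω')
    (hψprop : ∀ ω, ω ⊆ E₁ → c ∉ openCluster (ends '' (↑ω : Set ι)) a → c ∉ openCluster (ends '' (↑(E₁ \ ω) : Set ι)) a →
      c ∉ openCluster (ends '' (↑(ψ₁ ω) : Set ι)) a) :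
    0 ≤ ∑ ω₁ ∈ E₁.powerset, ∑ ω₂ ∈ E₂.powerset,
      ((if c ∉ openCluster (ends '' (↑ω₁ : Set ι)) a ∧ b ∈ openCluster (ends '' (↑ω₂ : Set ι)) c then
          h (openCluster (ends '' (↑(ω₁ ∪ ω₂) : Set ι)) a ∪ openCluster (ends '' (↑(ω₁ ∪ ω₂) : Set ι)) b) *
            k (openCluster (ends '' (↑(ω₁ ∪ ω₂) : Set ι)) a ∪ openCluster (ends '' (↑(ω₁ ∪ ω₂) : Set ι)) b) else 0)
      + (if (c ∉ openCluster (ends '' (↑ω₁ : Set ι)) a ∧ c ∉ openCluster (ends '' (↑(E₁ \ ω₁) : Set ι)) a) ∧ b ∈ openCluster (ends '' (↑(E₂ \ ω₂) : Set ι)) c then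
          (ha (openCluster (ends '' (↑(ω₁ ∪ ω₂) : Set ι)) a) - hb (openCluster (ends '' (↑((E₁ \ ω₁) ∪ (E₂ \ ω₂)) : Set ι)) b)) *
            (ka (openCluster (ends '' (↑(ω₁ ∪ ω₂) : Set ι)) a) - kb (openCluster (ends '' (↑((E₁ \ ω₁) ∪ (E₂ \ ω₂)) : Set ι)) b)) else 0)) := by
  set C : Finset ι → V → Set V := fun ω v => openCluster (ends '' (↑ω : Set ι)) v with hC
  change 0 ≤ ∑ ω₁ ∈ E₁.powerset, ∑ ω₂ ∈ E₂.powerset,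
      ((if c ∉ C ω₁ a ∧ b ∈ C ω₂ c then h (C (ω₁ ∪ ω₂) a ∪ C (ω₁ ∪ ω₂) b) * k (C (ω₁ ∪ ω₂) a ∪ C (ω₁ ∪ ω₂) b) else 0)
      + (if (c ∉ C ω₁ a ∧ c ∉ C (E₁ \ ω₁) a) ∧ b ∈ C (E₂ \ ω₂) c then
          (ha (C (ω₁ ∪ ω₂) a) - hb (C ((E₁ \ ω₁) ∪ (E₂ \ ω₂)) b)) * (ka (C (ω₁ ∪ ω₂) a) - kb (C ((E₁ \ ω₁) ∪ (E₂ \ ω₂)) b)) else 0))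
  have hCmono : ∀ {ω ω' : Finset ι} (v : V), ω ⊆ ω' → C ω v ⊆ C ω' v := fun v hle => openCluster_image_mono ends hle v
  have hh0 : ∀ X, 0 ≤ h X := fun X => le_trans (ha0 X) (hah X)
  have hk0 : ∀ X, 0 ≤ k X := fun X => le_trans (ka0 X) (kak X)
  have cutA : ∀ ω₁ ω₂ : Finset ι, ω₁ ⊆ E₁ → ω₂ ⊆ E₂ → C (ω₁ ∪ ω₂) a = C ω₁ a ∪ {y | c ∈ C ω₁ a ∧ y ∈ C ω₂ c} :=
    fun ω₁ ω₂ h1 h2 => openCluster_cut_side ends E₁ E₂ ω₁ ω₂ c a hsep h1 h2 haE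
  have cutB : ∀ ω₁ ω₂ : Finset ι, ω₁ ⊆ E₁ → ω₂ ⊆ E₂ → C (ω₁ ∪ ω₂) b = C ω₂ b ∪ {y | c ∈ C ω₂ b ∧ y ∈ C ω₁ c} := by
    intro ω₁ ω₂ h1 h2
    rw [Finset.union_comm]
    exact openCluster_cut_side ends E₂ E₁ ω₂ ω₁ c b (fun i hi j hj u hui huj => hsep j hj i hi u huj hui) h2 h1 hbE
  -- exchange the sums, then reindex the outer sum over ω₂ by the swap on E₂
  rw [Finset.sum_comm]
  set G : Finset ι → ℝ := fun ω₂ => ∑ ω₁ ∈ E₁.powerset,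
      ((if c ∉ C ω₁ a ∧ b ∈ C ω₂ c then h (C (ω₁ ∪ ω₂) a ∪ C (ω₁ ∪ ω₂) b) * k (C (ω₁ ∪ ω₂) a ∪ C (ω₁ ∪ ω₂) b) else 0)
      + (if (c ∉ C ω₁ a ∧ c ∉ C (E₁ \ ω₁) a) ∧ b ∈ C (E₂ \ ω₂) c then
          (ha (C (ω₁ ∪ ω₂) a) - hb (C ((E₁ \ ω₁) ∪ (E₂ \ ω₂)) b)) * (ka (C (ω₁ ∪ ω₂) a) - kb (C ((E₁ \ ω₁) ∪ (E₂ \ ω₂)) b)) else 0)) with hG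
  change 0 ≤ ∑ ω₂ ∈ E₂.powerset, G ω₂
  -- split G into supply part and wall part, reindex the supply part
  set GS : Finset ι → ℝ := fun ω₂ => ∑ ω₁ ∈ E₁.powerset,
      (if c ∉ C ω₁ a ∧ b ∈ C ω₂ c then h (C (ω₁ ∪ ω₂) a ∪ C (ω₁ ∪ ω₂) b) * k (C (ω₁ ∪ ω₂) a ∪ C (ω₁ ∪ ω₂) b) else 0) with hGS
  set GW : Finset ι → ℝ := fun ω₂ => ∑ ω₁ ∈ E₁.powerset,
      (if (c ∉ C ω₁ a ∧ c ∉ C (E₁ \ ω₁) a) ∧ b ∈ C (E₂ \ ω₂) c then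
          (ha (C (ω₁ ∪ ω₂) a) - hb (C ((E₁ \ ω₁) ∪ (E₂ \ ω₂)) b)) * (ka (C (ω₁ ∪ ω₂) a) - kb (C ((E₁ \ ω₁) ∪ (E₂ \ ω₂)) b)) else 0) with hGW
  have hGsplit : ∀ ω₂, G ω₂ = GS ω₂ + GW ω₂ := fun ω₂ => by simp only [hG, hGS, hGW, Finset.sum_add_distrib]
  simp only [hGsplit]
  rw [Finset.sum_add_distrib, ← sum_powerset_sdiff E₂ GS, ← Finset.sum_add_distrib]
  refine Finset.sum_nonneg fun ω₂ hω₂ => ?_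
  have hω₂ := Finset.mem_powerset.mp hω₂
  by_cases hb2 : b ∈ C (E₂ \ ω₂) c
  swap
  · have h1 : GS (E₂ \ ω₂) = 0 := by
      simp only [hGS]
      exact Finset.sum_eq_zero fun ω₁ _ => by rw [if_neg (fun hx => hb2 hx.2)]
    have h2 : GW ω₂ = 0 := by
      simp only [hGW]
      exact Finset.sum_eq_zero fun ω₁ _ => by rw [if_neg (fun hx => hb2 hx.2)]
    rw [h1, h2]; linarith
  -- now b ∈ C_c(E₂∖ω₂): supply at (ψ₁ ω₁, E₂∖ω₂) for ω₁ ∈ T₁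
  set Y : Finset ι → ℝ := fun ω₁ => h (C (ω₁ ∪ (E₂ \ ω₂)) a ∪ C (ω₁ ∪ (E₂ \ ω₂)) b) * k (C (ω₁ ∪ (E₂ \ ω₂)) a ∪ C (ω₁ ∪ (E₂ \ ω₂)) b) with hY
  have hY0 : ∀ ω₁, 0 ≤ Y ω₁ := fun ω₁ => mul_nonneg (hh0 _) (hk0 _)
  set T₁ : Finset (Finset ι) := E₁.powerset.filter (fun ω₁ => c ∉ C ω₁ a ∧ c ∉ C (E₁ \ ω₁) a) with hT₁
  have hT₁mem : ∀ {ω₁}, ω₁ ∈ T₁ ↔ ω₁ ⊆ E₁ ∧ c ∉ C ω₁ a ∧ c ∉ C (E₁ \ ω₁) a := fun {ω₁} => by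
    rw [hT₁, Finset.mem_filter, Finset.mem_powerset]
  have hGSval : GS (E₂ \ ω₂) = ∑ ω₁ ∈ E₁.powerset, (if c ∉ C ω₁ a ∧ b ∈ C (E₂ \ ω₂) c then Y ω₁ else 0) := rfl
  have lower : ∑ ω₁ ∈ T₁, Y (ψ₁ ω₁) ≤ GS (E₂ \ ω₂) := by
    rw [hGSval]
    have hinj : ∀ x ∈ T₁, ∀ y ∈ T₁, ψ₁ x = ψ₁ y → x = y := by
      intro x hx y hy he
      obtain ⟨s1, r1, b1⟩ := hT₁mem.mp hx
      obtain ⟨s2, r2, b2⟩ := hT₁mem.mp hy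
      exact hψinj x y s1 r1 b1 s2 r2 b2 he
    have e1 : ∑ ω₁ ∈ T₁, Y (ψ₁ ω₁) = ∑ ω' ∈ T₁.image ψ₁, Y ω' := (Finset.sum_image (f := fun ω' => Y ω') hinj).symm
    rw [e1, ← Finset.sum_filter]
    refine Finset.sum_le_sum_of_subset_of_nonneg ?_ (fun ω _ _ => hY0 ω)
    intro ω' hω'
    rw [Finset.mem_image] at hω'
    obtain ⟨ω₁, hω₁, rfl⟩ := hω'
    obtain ⟨s1, r1, b1⟩ := hT₁mem.mp hω₁
    rw [Finset.mem_filter, Finset.mem_powerset]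
    exact ⟨hψE ω₁ s1 r1 b1, hψprop ω₁ s1 r1 b1, hb2⟩
  have wall_eq : GW ω₂ = ∑ ω₁ ∈ T₁, (ha (C (ω₁ ∪ ω₂) a) - hb (C ((E₁ \ ω₁) ∪ (E₂ \ ω₂)) b)) * (ka (C (ω₁ ∪ ω₂) a) - kb (C ((E₁ \ ω₁) ∪ (E₂ \ ω₂)) b)) := by
    simp only [hGW]
    rw [hT₁, Finset.sum_filter]
    refine Finset.sum_congr rfl fun ω₁ _ => ?_
    by_cases hw : c ∉ C ω₁ a ∧ c ∉ C (E₁ \ ω₁) a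
    · rw [if_pos ⟨hw, hb2⟩, if_pos hw]
    · rw [if_neg (fun hx => hw hx.1), if_neg hw]
  have step : 0 ≤ ∑ ω₁ ∈ T₁, ((ha (C (ω₁ ∪ ω₂) a) - hb (C ((E₁ \ ω₁) ∪ (E₂ \ ω₂)) b)) * (ka (C (ω₁ ∪ ω₂) a) - kb (C ((E₁ \ ω₁) ∪ (E₂ \ ω₂)) b))
      + Y (ψ₁ ω₁)) := by
    refine Finset.sum_nonneg fun ω₁ hω₁ => ?_
    obtain ⟨s1, r1, b1⟩ := hT₁mem.mp hω₁
    have hcov := hψcov ω₁ s1 r1 b1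
    have hψs : ψ₁ ω₁ ⊆ E₁ := hψE ω₁ s1 r1 b1
    set Sst : Set V := C (ψ₁ ω₁ ∪ (E₂ \ ω₂)) a ∪ C (ψ₁ ω₁ ∪ (E₂ \ ω₂)) b with hSst
    -- b ~ c in E₂∖ω₂, hence C_b(ψ₁ω₁ ∪ (E₂∖ω₂)) ⊇ C_c(ψ₁ ω₁)
    have hbc' : b ∈ C (ψ₁ ω₁ ∪ (E₂ \ ω₂)) c := hCmono c Finset.subset_union_right hb2
    have hbc : c ∈ C (ψ₁ ω₁ ∪ (E₂ \ ω₂)) b := (mem_openCluster_comm ends (ψ₁ ω₁ ∪ (E₂ \ ω₂)) c b).mp hbc'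
    have hAψ : C (ψ₁ ω₁) a ⊆ Sst := fun y hy => Or.inl (hCmono a Finset.subset_union_left hy)
    have hCψ : C (ψ₁ ω₁) c ⊆ Sst := fun y hy =>
      Or.inr (SimpleGraph.Reachable.trans hbc (hCmono c Finset.subset_union_left hy))
    have hcovS : C ω₁ a ∪ C (E₁ \ ω₁) c ⊆ Sst := by
      intro y hy
      rcases hcov hy with h' | h'
      · exact hAψ h'
      · exact hCψ h'
    have hP : C (ω₁ ∪ ω₂) a ⊆ Sst := by
      intro y hy
      rw [cutA ω₁ ω₂ s1 hω₂] at hy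
      rcases hy with hy | ⟨hc, _⟩
      · exact hcovS (Or.inl hy)
      · exact absurd hc r1
    have hQ : C ((E₁ \ ω₁) ∪ (E₂ \ ω₂)) b ⊆ Sst := by
      intro y hy
      rw [cutB (E₁ \ ω₁) (E₂ \ ω₂) Finset.sdiff_subset Finset.sdiff_subset] at hy
      rcases hy with hy | ⟨_, hy⟩
      · exact Or.inr (hCmono b Finset.subset_union_right hy)
      · exact hcovS (Or.inr hy)
    have := mul_add_sub_mul_sub_nonneg (A := h Sst) (B := k Sst)
      (α := ha (C (ω₁ ∪ ω₂) a)) (β := hb (C ((E₁ \ ω₁) ∪ (E₂ \ ω₂)) b)) (γ := ka (C (ω₁ ∪ ω₂) a)) (δ := kb (C ((E₁ \ ω₁) ∪ (E₂ \ ω₂)) b))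
      (ha0 _) (le_trans (hah _) (hh hP)) (hb0 _) (le_trans (hbh _) (hh hQ))
      (ka0 _) (le_trans (kak _) (hk hP)) (kb0 _) (le_trans (kbk _) (hk hQ))
    simp only [hY]; linarith
  rw [wall_eq]
  rw [Finset.sum_add_distrib] at step
  linarith

end Coefficientwise

end Summit.CriticalPhenomena.PercolationContinuityZ3.Theorems
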